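import Summits.CriticalPhenomena.PercolationContinuityZ3.Theorems.Transplant.FKConnectivityAllQPat3GenDict
import Summits.CriticalPhenomena.PercolationContinuityZ3.Theorems.Transplant.FKConnectivityAllQPat3FastCheck
import HarnessLib

/-!
# Connectivity correlation inequalities for `φ_{w,q}`, every `q > 0` — THEOREM SP DATA: the THETA certificate for `starXTab`,
# part 1 of 3 (Stage S2 data file; 181 products, denominator 17216; 125 row-sized kernel evaluations over three files)

Theorems + data file (`--supports stmt-CriticalPhenomena-4575`), census lane `prim-bschramm-census` (gen 36) of the post-continuity programme (LANE 2 bschramm, FK sub-lane);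
builds on p205010 (kernel theorem, internal audit signed; external expert review pending).
No named facts, no sorries; standard axioms (`decide +kernel` only: kernel evaluation, no compiled evaluation).  Census g34's THETA certificate for the
target `starXTab` re-derived by LP in ordered pattern tables (181 products), checked by the kernel through `FK.rowG` in 125 small
declarations (rows `(P_K, Q_K, P_1)`; per-declaration memory sized for the smaller farm nodes), `FK.loop1G_of_rows`, and assembled
in part 3 by `FK.symCert_of_pairs` into **`FK.thetaStar_level_nonneg`**.
[cite: AyyerLinussonRavichandran2025, §7 eq. (13)–(15) (p. 22)] [cite: Grimmett2006, §3.8 (pp. 61–62)]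
-/

noncomputable section

namespace Summit.CriticalPhenomena.PercolationContinuityZ3.Theorems

namespace FK

open SimpleGraph Literature.Probability.LatticeModels Literature.Probability.Percolation

section Data

/- Sequential elaboration: the kernel evaluations below must not run concurrently (memory on the smaller farm nodes;
census g36 measured: 50 concurrent row evaluations are killed, sequential ones take ≈ 5 s each). -/
set_option Elab.async false

open scoped Classical

variable {V : Type*} [Fintype V]

/-! ### The data -/

/-- The 181 products of the THETA certificate for the target `starXTab` (common denominator `17216`, shifts `≤ 3`), found by
census g36's LP `code/lp/main.py` in ordered pattern tables: `⟨λ·D, κ, g_K, g_1, g_2⟩`. [folklore] -/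
def prodsThetaStar : List Prod3G :=
  [⟨1670, 0, Gen.fam tsym2Tab, Gen.fam tsym2Tab, Gen.fam tsym2Tab⟩, ⟨144, 3, Gen.fam tsym2Tab, Gen.fam tsym2Tab, Gen.fam tsym2Tab⟩,
  ⟨400, 0, Gen.fam tsym2Tab, Gen.fam tsym2Tab, Gen.fam c1Tab⟩, ⟨932, 0, Gen.fam tsym2Tab, Gen.fam tsym2Tab, Gen.fam c2Tab⟩,
  ⟨1570, 1, Gen.fam tsym2Tab, Gen.fam tsym2Tab, Gen.orb Pat3.all Pat3.xs_y⟩, ⟨1538, 1, Gen.fam tsym2Tab, Gen.fam tsym2Tab, Gen.orb Pat3.all Pat3.ys_x⟩,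
  ⟨2072, 1, Gen.fam tsym2Tab, Gen.fam tsym2Tab, Gen.orb Pat3.xy_s Pat3.xs_y⟩, ⟨2040, 1, Gen.fam tsym2Tab, Gen.fam tsym2Tab, Gen.orb Pat3.xy_s Pat3.ys_x⟩,
  ⟨3308, 0, Gen.fam tsym2Tab, Gen.fam tsym2Tab, Gen.orb Pat3.xs_y Pat3.xs_y⟩, ⟨4304, 0, Gen.fam tsym2Tab, Gen.fam tsym2Tab, Gen.orb Pat3.xs_y Pat3.ys_x⟩,
  ⟨322, 0, Gen.fam tsym2Tab, Gen.fam tsym2Tab, Gen.orb Pat3.xs_y Pat3.sep⟩, ⟨3244, 0, Gen.fam tsym2Tab, Gen.fam tsym2Tab, Gen.orb Pat3.ys_x Pat3.ys_x⟩,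
  ⟨290, 0, Gen.fam tsym2Tab, Gen.fam tsym2Tab, Gen.orb Pat3.ys_x Pat3.sep⟩, ⟨338, 0, Gen.fam tsym2Tab, Gen.fam starXTab, Gen.fam tsym2Tab⟩,
  ⟨232, 1, Gen.fam tsym2Tab, Gen.fam starXTab, Gen.fam starXTab⟩, ⟨1248, 1, Gen.fam tsym2Tab, Gen.fam starXTab, Gen.orb Pat3.all Pat3.xs_y⟩,
  ⟨216, 2, Gen.fam tsym2Tab, Gen.fam starXTab, Gen.orb Pat3.all Pat3.xs_y⟩, ⟨24, 2, Gen.fam tsym2Tab, Gen.fam starXTab, Gen.orb Pat3.all Pat3.ys_x⟩,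
  ⟨342, 1, Gen.fam tsym2Tab, Gen.fam starXTab, Gen.orb Pat3.all Pat3.sep⟩, ⟨906, 1, Gen.fam tsym2Tab, Gen.fam starXTab, Gen.orb Pat3.xy_s Pat3.xs_y⟩,
  ⟨384, 2, Gen.fam tsym2Tab, Gen.fam starXTab, Gen.orb Pat3.xy_s Pat3.xs_y⟩, ⟨32, 1, Gen.fam tsym2Tab, Gen.fam starXTab, Gen.orb Pat3.xy_s Pat3.ys_x⟩,
  ⟨248, 2, Gen.fam tsym2Tab, Gen.fam starXTab, Gen.orb Pat3.xy_s Pat3.ys_x⟩, ⟨1082, 1, Gen.fam tsym2Tab, Gen.fam starXTab, Gen.orb Pat3.xs_y Pat3.ys_x⟩,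
  ⟨384, 1, Gen.fam tsym2Tab, Gen.fam starXTab, Gen.orb Pat3.ys_x Pat3.ys_x⟩, ⟨400, 1, Gen.fam tsym2Tab, Gen.fam starXTab, Gen.orb Pat3.ys_x Pat3.sep⟩,
  ⟨232, 1, Gen.fam tsym2Tab, Gen.fam (mirror2 starXTab), Gen.fam (mirror2 starXTab)⟩, ⟨24, 2, Gen.fam tsym2Tab, Gen.fam (mirror2 starXTab), Gen.orb Pat3.all Pat3.xs_y⟩,
  ⟨1248, 1, Gen.fam tsym2Tab, Gen.fam (mirror2 starXTab), Gen.orb Pat3.all Pat3.ys_x⟩, ⟨216, 2, Gen.fam tsym2Tab, Gen.fam (mirror2 starXTab), Gen.orb Pat3.all Pat3.ys_x⟩,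
  ⟨374, 1, Gen.fam tsym2Tab, Gen.fam (mirror2 starXTab), Gen.orb Pat3.all Pat3.sep⟩, ⟨248, 2, Gen.fam tsym2Tab, Gen.fam (mirror2 starXTab), Gen.orb Pat3.xy_s Pat3.xs_y⟩,
  ⟨874, 1, Gen.fam tsym2Tab, Gen.fam (mirror2 starXTab), Gen.orb Pat3.xy_s Pat3.ys_x⟩, ⟨384, 2, Gen.fam tsym2Tab, Gen.fam (mirror2 starXTab), Gen.orb Pat3.xy_s Pat3.ys_x⟩,
  ⟨384, 1, Gen.fam tsym2Tab, Gen.fam (mirror2 starXTab), Gen.orb Pat3.xs_y Pat3.xs_y⟩, ⟨1050, 1, Gen.fam tsym2Tab, Gen.fam (mirror2 starXTab), Gen.orb Pat3.xs_y Pat3.ys_x⟩,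
  ⟨400, 1, Gen.fam tsym2Tab, Gen.fam (mirror2 starXTab), Gen.orb Pat3.xs_y Pat3.sep⟩, ⟨72, 1, Gen.fam tsym2Tab, Gen.fam c1Tab, Gen.orb Pat3.xs_y Pat3.ys_x⟩,
  ⟨208, 2, Gen.fam tsym2Tab, Gen.fam c1Tab, Gen.orb Pat3.xs_y Pat3.ys_x⟩, ⟨128, 1, Gen.fam tsym2Tab, Gen.fam c3Tab, Gen.orb Pat3.all Pat3.sep⟩,
  ⟨496, 2, Gen.fam tsym2Tab, Gen.fam s1c1Tab, Gen.orb Pat3.all Pat3.ys_x⟩, ⟨496, 2, Gen.fam tsym2Tab, Gen.fam s1c1Tab, Gen.orb Pat3.xy_s Pat3.ys_x⟩,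
  ⟨380, 1, Gen.fam tsym2Tab, Gen.fam s1c1Tab, Gen.orb Pat3.xs_y Pat3.ys_x⟩, ⟨496, 2, Gen.fam tsym2Tab, Gen.fam (mirror2 s1c1Tab), Gen.orb Pat3.all Pat3.xs_y⟩,
  ⟨496, 2, Gen.fam tsym2Tab, Gen.fam (mirror2 s1c1Tab), Gen.orb Pat3.xy_s Pat3.xs_y⟩, ⟨212, 1, Gen.fam tsym2Tab, Gen.fam (mirror2 s1c1Tab), Gen.orb Pat3.xs_y Pat3.ys_x⟩,
  ⟨168, 1, Gen.fam tsym2Tab, Gen.fam (mirror2 s1c3Tab), Gen.orb Pat3.xs_y Pat3.ys_x⟩, ⟨2962, 1, Gen.fam tsym2Tab, Gen.orb Pat3.all Pat3.xs_y, Gen.fam tsym2Tab⟩,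
  ⟨1288, 1, Gen.fam tsym2Tab, Gen.orb Pat3.all Pat3.xs_y, Gen.fam starXTab⟩, ⟨224, 2, Gen.fam tsym2Tab, Gen.orb Pat3.all Pat3.xs_y, Gen.fam starXTab⟩,
  ⟨412, 2, Gen.fam tsym2Tab, Gen.orb Pat3.all Pat3.xs_y, Gen.fam (mirror2 s1c1Tab)⟩, ⟨2318, 1, Gen.fam tsym2Tab, Gen.orb Pat3.all Pat3.ys_x, Gen.fam tsym2Tab⟩,
  ⟨1288, 1, Gen.fam tsym2Tab, Gen.orb Pat3.all Pat3.ys_x, Gen.fam (mirror2 starXTab)⟩, ⟨224, 2, Gen.fam tsym2Tab, Gen.orb Pat3.all Pat3.ys_x, Gen.fam (mirror2 starXTab)⟩,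
  ⟨412, 2, Gen.fam tsym2Tab, Gen.orb Pat3.all Pat3.ys_x, Gen.fam s1c1Tab⟩, ⟨490, 1, Gen.fam tsym2Tab, Gen.orb Pat3.all Pat3.sep, Gen.fam starXTab⟩,
  ⟨458, 1, Gen.fam tsym2Tab, Gen.orb Pat3.all Pat3.sep, Gen.fam (mirror2 starXTab)⟩, ⟨3452, 1, Gen.fam tsym2Tab, Gen.orb Pat3.xy_s Pat3.xs_y, Gen.fam tsym2Tab⟩,
  ⟨798, 1, Gen.fam tsym2Tab, Gen.orb Pat3.xy_s Pat3.xs_y, Gen.fam starXTab⟩, ⟨368, 2, Gen.fam tsym2Tab, Gen.orb Pat3.xy_s Pat3.xs_y, Gen.fam starXTab⟩,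
  ⟨32, 1, Gen.fam tsym2Tab, Gen.orb Pat3.xy_s Pat3.xs_y, Gen.fam (mirror2 starXTab)⟩, ⟨40, 2, Gen.fam tsym2Tab, Gen.orb Pat3.xy_s Pat3.xs_y, Gen.fam (mirror2 starXTab)⟩,
  ⟨576, 2, Gen.fam tsym2Tab, Gen.orb Pat3.xy_s Pat3.xs_y, Gen.fam (mirror2 s1c1Tab)⟩, ⟨2808, 1, Gen.fam tsym2Tab, Gen.orb Pat3.xy_s Pat3.ys_x, Gen.fam tsym2Tab⟩,
  ⟨40, 2, Gen.fam tsym2Tab, Gen.orb Pat3.xy_s Pat3.ys_x, Gen.fam starXTab⟩, ⟨830, 1, Gen.fam tsym2Tab, Gen.orb Pat3.xy_s Pat3.ys_x, Gen.fam (mirror2 starXTab)⟩,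
  ⟨368, 2, Gen.fam tsym2Tab, Gen.orb Pat3.xy_s Pat3.ys_x, Gen.fam (mirror2 starXTab)⟩, ⟨576, 2, Gen.fam tsym2Tab, Gen.orb Pat3.xy_s Pat3.ys_x, Gen.fam s1c1Tab⟩,
  ⟨3348, 0, Gen.fam tsym2Tab, Gen.orb Pat3.xs_y Pat3.xs_y, Gen.fam tsym2Tab⟩, ⟨336, 1, Gen.fam tsym2Tab, Gen.orb Pat3.xs_y Pat3.xs_y, Gen.fam (mirror2 starXTab)⟩,
  ⟨4304, 0, Gen.fam tsym2Tab, Gen.orb Pat3.xs_y Pat3.ys_x, Gen.fam tsym2Tab⟩, ⟨94, 1, Gen.fam tsym2Tab, Gen.orb Pat3.xs_y Pat3.ys_x, Gen.fam starXTab⟩,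
  ⟨822, 1, Gen.fam tsym2Tab, Gen.orb Pat3.xs_y Pat3.ys_x, Gen.fam (mirror2 starXTab)⟩, ⟨80, 2, Gen.fam tsym2Tab, Gen.orb Pat3.xs_y Pat3.ys_x, Gen.fam c1Tab⟩,
  ⟨696, 1, Gen.fam tsym2Tab, Gen.orb Pat3.xs_y Pat3.ys_x, Gen.fam s1c1Tab⟩, ⟨696, 1, Gen.fam tsym2Tab, Gen.orb Pat3.xs_y Pat3.ys_x, Gen.fam (mirror2 s1c1Tab)⟩,
  ⟨1674, 0, Gen.fam tsym2Tab, Gen.orb Pat3.xs_y Pat3.sep, Gen.fam tsym2Tab⟩, ⟨376, 1, Gen.fam tsym2Tab, Gen.orb Pat3.xs_y Pat3.sep, Gen.fam (mirror2 starXTab)⟩,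
  ⟨80, 0, Gen.fam tsym2Tab, Gen.orb Pat3.xs_y Pat3.sep, Gen.orb Pat3.xs_y Pat3.sep⟩, ⟨2060, 0, Gen.fam tsym2Tab, Gen.orb Pat3.ys_x Pat3.ys_x, Gen.fam tsym2Tab⟩,
  ⟨336, 1, Gen.fam tsym2Tab, Gen.orb Pat3.ys_x Pat3.ys_x, Gen.fam starXTab⟩, ⟨1030, 0, Gen.fam tsym2Tab, Gen.orb Pat3.ys_x Pat3.sep, Gen.fam tsym2Tab⟩,
  ⟨376, 1, Gen.fam tsym2Tab, Gen.orb Pat3.ys_x Pat3.sep, Gen.fam starXTab⟩, ⟨80, 0, Gen.fam tsym2Tab, Gen.orb Pat3.ys_x Pat3.sep, Gen.orb Pat3.ys_x Pat3.sep⟩,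
  ⟨3, 0, Gen.fam starSTab, Gen.fam tsym2Tab, Gen.fam starXTab⟩, ⟨19, 0, Gen.fam starSTab, Gen.fam tsym2Tab, Gen.fam (mirror2 starXTab)⟩,
  ⟨168, 0, Gen.fam starSTab, Gen.fam tsym2Tab, Gen.fam c3Tab⟩, ⟨1504, 0, Gen.fam starSTab, Gen.fam tsym2Tab, Gen.orb Pat3.xs_y Pat3.xs_y⟩,
  ⟨624, 0, Gen.fam starSTab, Gen.fam tsym2Tab, Gen.orb Pat3.xs_y Pat3.sep⟩, ⟨1504, 0, Gen.fam starSTab, Gen.fam tsym2Tab, Gen.orb Pat3.ys_x Pat3.ys_x⟩,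
  ⟨624, 0, Gen.fam starSTab, Gen.fam tsym2Tab, Gen.orb Pat3.ys_x Pat3.sep⟩, ⟨93, 0, Gen.fam starSTab, Gen.fam starXTab, Gen.fam tsym2Tab⟩,
  ⟨32, 1, Gen.fam starSTab, Gen.fam starXTab, Gen.fam tsym2Tab⟩, ⟨192, 0, Gen.fam starSTab, Gen.fam starXTab, Gen.fam (mirror2 starXTab)⟩,
  ⟨240, 1, Gen.fam starSTab, Gen.fam starXTab, Gen.orb Pat3.all Pat3.ys_x⟩, ⟨112, 1, Gen.fam starSTab, Gen.fam starXTab, Gen.orb Pat3.xy_s Pat3.ys_x⟩,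
  ⟨1808, 0, Gen.fam starSTab, Gen.fam starXTab, Gen.orb Pat3.xs_y Pat3.xs_y⟩, ⟨864, 0, Gen.fam starSTab, Gen.fam starXTab, Gen.orb Pat3.xs_y Pat3.sep⟩,
  ⟨77, 0, Gen.fam starSTab, Gen.fam (mirror2 starXTab), Gen.fam tsym2Tab⟩, ⟨32, 1, Gen.fam starSTab, Gen.fam (mirror2 starXTab), Gen.fam tsym2Tab⟩,
  ⟨192, 0, Gen.fam starSTab, Gen.fam (mirror2 starXTab), Gen.fam starXTab⟩, ⟨240, 1, Gen.fam starSTab, Gen.fam (mirror2 starXTab), Gen.orb Pat3.all Pat3.xs_y⟩,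
  ⟨112, 1, Gen.fam starSTab, Gen.fam (mirror2 starXTab), Gen.orb Pat3.xy_s Pat3.xs_y⟩, ⟨1808, 0, Gen.fam starSTab, Gen.fam (mirror2 starXTab), Gen.orb Pat3.ys_x Pat3.ys_x⟩,
  ⟨864, 0, Gen.fam starSTab, Gen.fam (mirror2 starXTab), Gen.orb Pat3.ys_x Pat3.sep⟩, ⟨80, 0, Gen.fam starSTab, Gen.fam c1Tab, Gen.fam c1Tab⟩,
  ⟨128, 1, Gen.fam starSTab, Gen.fam c2Tab, Gen.orb Pat3.xy_s Pat3.xs_y⟩, ⟨128, 1, Gen.fam starSTab, Gen.fam c2Tab, Gen.orb Pat3.xy_s Pat3.ys_x⟩,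
  ⟨104, 0, Gen.fam starSTab, Gen.fam c3Tab, Gen.fam tsym2Tab⟩, ⟨272, 1, Gen.fam starSTab, Gen.orb Pat3.all Pat3.xs_y, Gen.fam (mirror2 starXTab)⟩,
  ⟨272, 1, Gen.fam starSTab, Gen.orb Pat3.all Pat3.ys_x, Gen.fam starXTab⟩, ⟨64, 2, Gen.fam starSTab, Gen.orb Pat3.xy_s Pat3.xs_y, Gen.fam tsym2Tab⟩,
  ⟨272, 1, Gen.fam starSTab, Gen.orb Pat3.xy_s Pat3.xs_y, Gen.fam (mirror2 starXTab)⟩, ⟨64, 2, Gen.fam starSTab, Gen.orb Pat3.xy_s Pat3.ys_x, Gen.fam tsym2Tab⟩,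
  ⟨272, 1, Gen.fam starSTab, Gen.orb Pat3.xy_s Pat3.ys_x, Gen.fam starXTab⟩, ⟨1232, 0, Gen.fam starSTab, Gen.orb Pat3.xs_y Pat3.xs_y, Gen.fam tsym2Tab⟩,
  ⟨1728, 0, Gen.fam starSTab, Gen.orb Pat3.xs_y Pat3.xs_y, Gen.fam starXTab⟩, ⟨160, 0, Gen.fam starSTab, Gen.orb Pat3.xs_y Pat3.xs_y, Gen.orb Pat3.ys_x Pat3.sep⟩,
  ⟨40, 2, Gen.fam starSTab, Gen.orb Pat3.xs_y Pat3.ys_x, Gen.fam tsym2Tab⟩, ⟨552, 0, Gen.fam starSTab, Gen.orb Pat3.xs_y Pat3.sep, Gen.fam tsym2Tab⟩,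
  ⟨824, 0, Gen.fam starSTab, Gen.orb Pat3.xs_y Pat3.sep, Gen.fam starXTab⟩, ⟨160, 0, Gen.fam starSTab, Gen.orb Pat3.xs_y Pat3.sep, Gen.orb Pat3.ys_x Pat3.ys_x⟩,
  ⟨80, 0, Gen.fam starSTab, Gen.orb Pat3.xs_y Pat3.sep, Gen.orb Pat3.ys_x Pat3.sep⟩, ⟨1232, 0, Gen.fam starSTab, Gen.orb Pat3.ys_x Pat3.ys_x, Gen.fam tsym2Tab⟩,
  ⟨1728, 0, Gen.fam starSTab, Gen.orb Pat3.ys_x Pat3.ys_x, Gen.fam (mirror2 starXTab)⟩, ⟨160, 0, Gen.fam starSTab, Gen.orb Pat3.ys_x Pat3.ys_x, Gen.orb Pat3.xs_y Pat3.sep⟩,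
  ⟨552, 0, Gen.fam starSTab, Gen.orb Pat3.ys_x Pat3.sep, Gen.fam tsym2Tab⟩, ⟨824, 0, Gen.fam starSTab, Gen.orb Pat3.ys_x Pat3.sep, Gen.fam (mirror2 starXTab)⟩,
  ⟨160, 0, Gen.fam starSTab, Gen.orb Pat3.ys_x Pat3.sep, Gen.orb Pat3.xs_y Pat3.xs_y⟩, ⟨80, 0, Gen.fam starSTab, Gen.orb Pat3.ys_x Pat3.sep, Gen.orb Pat3.xs_y Pat3.sep⟩,
  ⟨1952, 1, Gen.orb Pat3.all Pat3.xy_s, Gen.fam tsym2Tab, Gen.fam tsym2Tab⟩, ⟨530, 1, Gen.orb Pat3.all Pat3.xy_s, Gen.fam tsym2Tab, Gen.fam starXTab⟩,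
  ⟨498, 1, Gen.orb Pat3.all Pat3.xy_s, Gen.fam tsym2Tab, Gen.fam (mirror2 starXTab)⟩, ⟨446, 1, Gen.orb Pat3.all Pat3.xy_s, Gen.fam starXTab, Gen.fam tsym2Tab⟩,
  ⟨478, 1, Gen.orb Pat3.all Pat3.xy_s, Gen.fam (mirror2 starXTab), Gen.fam tsym2Tab⟩, ⟨784, 2, Gen.orb Pat3.all Pat3.xy_s, Gen.fam c2Tab, Gen.fam tsym2Tab⟩,
  ⟨2152, 1, Gen.orb Pat3.all Pat3.xs_y, Gen.fam starXTab, Gen.fam starXTab⟩, ⟨2152, 1, Gen.orb Pat3.all Pat3.ys_x, Gen.fam (mirror2 starXTab), Gen.fam (mirror2 starXTab)⟩,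
  ⟨64, 1, Gen.orb Pat3.all Pat3.sep, Gen.fam tsym2Tab, Gen.fam c1Tab⟩, ⟨16, 1, Gen.orb Pat3.all Pat3.sep, Gen.fam tsym2Tab, Gen.fam c2Tab⟩,
  ⟨288, 3, Gen.orb Pat3.all Pat3.sep, Gen.fam tsym2Tab, Gen.orb Pat3.xs_y Pat3.ys_x⟩, ⟨760, 1, Gen.orb Pat3.all Pat3.sep, Gen.fam c1Tab, Gen.orb Pat3.xs_y Pat3.ys_x⟩,
  ⟨80, 1, Gen.orb Pat3.all Pat3.sep, Gen.fam c2Tab, Gen.fam tsym2Tab⟩, ⟨1392, 1, Gen.orb Pat3.all Pat3.sep, Gen.orb Pat3.xs_y Pat3.ys_x, Gen.fam starXTab⟩,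
  ⟨3904, 0, Gen.orb Pat3.xy_s Pat3.xy_s, Gen.fam tsym2Tab, Gen.fam tsym2Tab⟩, ⟨1060, 0, Gen.orb Pat3.xy_s Pat3.xy_s, Gen.fam tsym2Tab, Gen.fam starXTab⟩,
  ⟨996, 0, Gen.orb Pat3.xy_s Pat3.xy_s, Gen.fam tsym2Tab, Gen.fam (mirror2 starXTab)⟩, ⟨892, 0, Gen.orb Pat3.xy_s Pat3.xy_s, Gen.fam starXTab, Gen.fam tsym2Tab⟩,
  ⟨956, 0, Gen.orb Pat3.xy_s Pat3.xy_s, Gen.fam (mirror2 starXTab), Gen.fam tsym2Tab⟩, ⟨1568, 1, Gen.orb Pat3.xy_s Pat3.xy_s, Gen.fam c2Tab, Gen.fam tsym2Tab⟩,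
  ⟨280, 1, Gen.orb Pat3.xy_s Pat3.xs_y, Gen.fam tsym2Tab, Gen.fam (mirror2 starXTab)⟩, ⟨416, 2, Gen.orb Pat3.xy_s Pat3.xs_y, Gen.fam tsym2Tab, Gen.fam c2Tab⟩,
  ⟨656, 1, Gen.orb Pat3.xy_s Pat3.xs_y, Gen.fam starXTab, Gen.fam starXTab⟩, ⟨216, 1, Gen.orb Pat3.xy_s Pat3.xs_y, Gen.fam (mirror2 starXTab), Gen.fam tsym2Tab⟩,
  ⟨288, 2, Gen.orb Pat3.xy_s Pat3.xs_y, Gen.fam c2Tab, Gen.fam tsym2Tab⟩, ⟨80, 2, Gen.orb Pat3.xy_s Pat3.xs_y, Gen.fam (mirror2 s1c1Tab), Gen.fam tsym2Tab⟩,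
  ⟨312, 1, Gen.orb Pat3.xy_s Pat3.ys_x, Gen.fam tsym2Tab, Gen.fam starXTab⟩, ⟨416, 2, Gen.orb Pat3.xy_s Pat3.ys_x, Gen.fam tsym2Tab, Gen.fam c2Tab⟩,
  ⟨184, 1, Gen.orb Pat3.xy_s Pat3.ys_x, Gen.fam starXTab, Gen.fam tsym2Tab⟩, ⟨656, 1, Gen.orb Pat3.xy_s Pat3.ys_x, Gen.fam (mirror2 starXTab), Gen.fam (mirror2 starXTab)⟩,
  ⟨288, 2, Gen.orb Pat3.xy_s Pat3.ys_x, Gen.fam c2Tab, Gen.fam tsym2Tab⟩, ⟨80, 2, Gen.orb Pat3.xy_s Pat3.ys_x, Gen.fam s1c1Tab, Gen.fam tsym2Tab⟩,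
  ⟨4304, 0, Gen.orb Pat3.xs_y Pat3.xs_y, Gen.fam starXTab, Gen.fam starXTab⟩, ⟨4304, 0, Gen.orb Pat3.xs_y Pat3.ys_x, Gen.fam tsym2Tab, Gen.fam tsym2Tab⟩,
  ⟨42, 2, Gen.orb Pat3.xs_y Pat3.ys_x, Gen.fam tsym2Tab, Gen.fam tsym2Tab⟩, ⟨808, 1, Gen.orb Pat3.xs_y Pat3.ys_x, Gen.fam tsym2Tab, Gen.fam c2Tab⟩,
  ⟨720, 2, Gen.orb Pat3.xs_y Pat3.ys_x, Gen.fam tsym2Tab, Gen.fam c2Tab⟩, ⟨2288, 1, Gen.orb Pat3.xs_y Pat3.ys_x, Gen.fam tsym2Tab, Gen.fam c3Tab⟩,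
  ⟨8608, 0, Gen.orb Pat3.xs_y Pat3.ys_x, Gen.fam tsym2Tab, Gen.orb Pat3.xs_y Pat3.ys_x⟩, ⟨3176, 1, Gen.orb Pat3.xs_y Pat3.ys_x, Gen.fam starXTab, Gen.orb Pat3.ys_x Pat3.sep⟩,
  ⟨3176, 1, Gen.orb Pat3.xs_y Pat3.ys_x, Gen.fam (mirror2 starXTab), Gen.orb Pat3.xs_y Pat3.sep⟩, ⟨1088, 1, Gen.orb Pat3.xs_y Pat3.ys_x, Gen.fam c1Tab, Gen.fam tsym2Tab⟩,
  ⟨12152, 1, Gen.orb Pat3.xs_y Pat3.ys_x, Gen.fam c1Tab, Gen.orb Pat3.xs_y Pat3.ys_x⟩, ⟨704, 2, Gen.orb Pat3.xs_y Pat3.ys_x, Gen.fam c2Tab, Gen.fam tsym2Tab⟩,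
  ⟨2112, 1, Gen.orb Pat3.xs_y Pat3.ys_x, Gen.fam c3Tab, Gen.fam tsym2Tab⟩, ⟨8608, 0, Gen.orb Pat3.xs_y Pat3.ys_x, Gen.orb Pat3.xs_y Pat3.ys_x, Gen.fam tsym2Tab⟩,
  ⟨1392, 1, Gen.orb Pat3.xs_y Pat3.ys_x, Gen.orb Pat3.xs_y Pat3.ys_x, Gen.fam (mirror2 starXTab)⟩, ⟨10128, 1, Gen.orb Pat3.xs_y Pat3.ys_x, Gen.orb Pat3.xs_y Pat3.ys_x, Gen.fam c1Tab⟩,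
  ⟨3280, 1, Gen.orb Pat3.xs_y Pat3.ys_x, Gen.orb Pat3.xs_y Pat3.sep, Gen.fam (mirror2 starXTab)⟩, ⟨3280, 1, Gen.orb Pat3.xs_y Pat3.ys_x, Gen.orb Pat3.ys_x Pat3.sep, Gen.fam starXTab⟩,
  ⟨4304, 0, Gen.orb Pat3.ys_x Pat3.ys_x, Gen.fam (mirror2 starXTab), Gen.fam (mirror2 starXTab)⟩]

/-- The raw products (tables) of the certificate. [folklore] -/
abbrev prodsLThetaStar : List Prod3 := prodsThetaStar.map Prod3G.toProd3

/-- The symmetrised target function of the certificate. [folklore] -/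
abbrev tauThetaStar : ℕ → Pat3 → Pat3 → Pat3 → Pat3 → Pat3 → Pat3 → ℤ := target3SymF join3 corr3 starXTab

/-- Every generator of the certificate passes its side condition (family membership / trivial). [folklore] -/
theorem thetaStar_ok : (prodsThetaStar.all Prod3G.ok) = true := by decide +kernel

/-- The shifts of the certificate are at most `3`. [folklore] -/
theorem thetaStar_shift : ((prodsThetaStar.map Prod3G.toProd3).all fun p => decide (p.shift ≤ 3)) = true := by decide +kernel

/-! ### Row checks, part 1 (kernel evaluation, one small declaration each) -/

/-- Row `(all, all, all)` of the ThetaStar certificate check (kernel evaluation). [folklore] -/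
theorem thetaStar_row_all_all_all :
    rowG tauThetaStar 8 17216 3 (prodsLThetaStar.filter fun p => suppAt p.gK Pat3.all Pat3.all) Pat3.all Pat3.all Pat3.all = true := by
  decide +kernel

/-- Row `(all, all, xy_s)` of the ThetaStar certificate check (kernel evaluation). [folklore] -/
theorem thetaStar_row_all_all_xy_s :
    rowG tauThetaStar 8 17216 3 (prodsLThetaStar.filter fun p => suppAt p.gK Pat3.all Pat3.all) Pat3.all Pat3.all Pat3.xy_s = true := by
  decide +kernel

/-- Row `(all, all, xs_y)` of the ThetaStar certificate check (kernel evaluation). [folklore] -/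
theorem thetaStar_row_all_all_xs_y :
    rowG tauThetaStar 8 17216 3 (prodsLThetaStar.filter fun p => suppAt p.gK Pat3.all Pat3.all) Pat3.all Pat3.all Pat3.xs_y = true := by
  decide +kernel

/-- Row `(all, all, ys_x)` of the ThetaStar certificate check (kernel evaluation). [folklore] -/
theorem thetaStar_row_all_all_ys_x :
    rowG tauThetaStar 8 17216 3 (prodsLThetaStar.filter fun p => suppAt p.gK Pat3.all Pat3.all) Pat3.all Pat3.all Pat3.ys_x = true := by
  decide +kernel

/-- Row `(all, all, sep)` of the ThetaStar certificate check (kernel evaluation). [folklore] -/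
theorem thetaStar_row_all_all_sep :
    rowG tauThetaStar 8 17216 3 (prodsLThetaStar.filter fun p => suppAt p.gK Pat3.all Pat3.all) Pat3.all Pat3.all Pat3.sep = true := by
  decide +kernel

/-- Row `(all, xy_s, all)` of the ThetaStar certificate check (kernel evaluation). [folklore] -/
theorem thetaStar_row_all_xy_s_all :
    rowG tauThetaStar 8 17216 3 (prodsLThetaStar.filter fun p => suppAt p.gK Pat3.all Pat3.xy_s) Pat3.all Pat3.xy_s Pat3.all = true := by
  decide +kernel

/-- Row `(all, xy_s, xy_s)` of the ThetaStar certificate check (kernel evaluation). [folklore] -/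
theorem thetaStar_row_all_xy_s_xy_s :
    rowG tauThetaStar 8 17216 3 (prodsLThetaStar.filter fun p => suppAt p.gK Pat3.all Pat3.xy_s) Pat3.all Pat3.xy_s Pat3.xy_s = true := by
  decide +kernel

/-- Row `(all, xy_s, xs_y)` of the ThetaStar certificate check (kernel evaluation). [folklore] -/
theorem thetaStar_row_all_xy_s_xs_y :
    rowG tauThetaStar 8 17216 3 (prodsLThetaStar.filter fun p => suppAt p.gK Pat3.all Pat3.xy_s) Pat3.all Pat3.xy_s Pat3.xs_y = true := by
  decide +kernel

/-- Row `(all, xy_s, ys_x)` of the ThetaStar certificate check (kernel evaluation). [folklore] -/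
theorem thetaStar_row_all_xy_s_ys_x :
    rowG tauThetaStar 8 17216 3 (prodsLThetaStar.filter fun p => suppAt p.gK Pat3.all Pat3.xy_s) Pat3.all Pat3.xy_s Pat3.ys_x = true := by
  decide +kernel

/-- Row `(all, xy_s, sep)` of the ThetaStar certificate check (kernel evaluation). [folklore] -/
theorem thetaStar_row_all_xy_s_sep :
    rowG tauThetaStar 8 17216 3 (prodsLThetaStar.filter fun p => suppAt p.gK Pat3.all Pat3.xy_s) Pat3.all Pat3.xy_s Pat3.sep = true := by
  decide +kernel

/-- Row `(all, xs_y, all)` of the ThetaStar certificate check (kernel evaluation). [folklore] -/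
theorem thetaStar_row_all_xs_y_all :
    rowG tauThetaStar 8 17216 3 (prodsLThetaStar.filter fun p => suppAt p.gK Pat3.all Pat3.xs_y) Pat3.all Pat3.xs_y Pat3.all = true := by
  decide +kernel

/-- Row `(all, xs_y, xy_s)` of the ThetaStar certificate check (kernel evaluation). [folklore] -/
theorem thetaStar_row_all_xs_y_xy_s :
    rowG tauThetaStar 8 17216 3 (prodsLThetaStar.filter fun p => suppAt p.gK Pat3.all Pat3.xs_y) Pat3.all Pat3.xs_y Pat3.xy_s = true := by
  decide +kernel

/-- Row `(all, xs_y, xs_y)` of the ThetaStar certificate check (kernel evaluation). [folklore] -/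
theorem thetaStar_row_all_xs_y_xs_y :
    rowG tauThetaStar 8 17216 3 (prodsLThetaStar.filter fun p => suppAt p.gK Pat3.all Pat3.xs_y) Pat3.all Pat3.xs_y Pat3.xs_y = true := by
  decide +kernel

/-- Row `(all, xs_y, ys_x)` of the ThetaStar certificate check (kernel evaluation). [folklore] -/
theorem thetaStar_row_all_xs_y_ys_x :
    rowG tauThetaStar 8 17216 3 (prodsLThetaStar.filter fun p => suppAt p.gK Pat3.all Pat3.xs_y) Pat3.all Pat3.xs_y Pat3.ys_x = true := by
  decide +kernel

/-- Row `(all, xs_y, sep)` of the ThetaStar certificate check (kernel evaluation). [folklore] -/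
theorem thetaStar_row_all_xs_y_sep :
    rowG tauThetaStar 8 17216 3 (prodsLThetaStar.filter fun p => suppAt p.gK Pat3.all Pat3.xs_y) Pat3.all Pat3.xs_y Pat3.sep = true := by
  decide +kernel

/-- Row `(all, ys_x, all)` of the ThetaStar certificate check (kernel evaluation). [folklore] -/
theorem thetaStar_row_all_ys_x_all :
    rowG tauThetaStar 8 17216 3 (prodsLThetaStar.filter fun p => suppAt p.gK Pat3.all Pat3.ys_x) Pat3.all Pat3.ys_x Pat3.all = true := by
  decide +kernel

/-- Row `(all, ys_x, xy_s)` of the ThetaStar certificate check (kernel evaluation). [folklore] -/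
theorem thetaStar_row_all_ys_x_xy_s :
    rowG tauThetaStar 8 17216 3 (prodsLThetaStar.filter fun p => suppAt p.gK Pat3.all Pat3.ys_x) Pat3.all Pat3.ys_x Pat3.xy_s = true := by
  decide +kernel

/-- Row `(all, ys_x, xs_y)` of the ThetaStar certificate check (kernel evaluation). [folklore] -/
theorem thetaStar_row_all_ys_x_xs_y :
    rowG tauThetaStar 8 17216 3 (prodsLThetaStar.filter fun p => suppAt p.gK Pat3.all Pat3.ys_x) Pat3.all Pat3.ys_x Pat3.xs_y = true := by
  decide +kernel

/-- Row `(all, ys_x, ys_x)` of the ThetaStar certificate check (kernel evaluation). [folklore] -/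
theorem thetaStar_row_all_ys_x_ys_x :
    rowG tauThetaStar 8 17216 3 (prodsLThetaStar.filter fun p => suppAt p.gK Pat3.all Pat3.ys_x) Pat3.all Pat3.ys_x Pat3.ys_x = true := by
  decide +kernel

/-- Row `(all, ys_x, sep)` of the ThetaStar certificate check (kernel evaluation). [folklore] -/
theorem thetaStar_row_all_ys_x_sep :
    rowG tauThetaStar 8 17216 3 (prodsLThetaStar.filter fun p => suppAt p.gK Pat3.all Pat3.ys_x) Pat3.all Pat3.ys_x Pat3.sep = true := by
  decide +kernel

/-- Row `(all, sep, all)` of the ThetaStar certificate check (kernel evaluation). [folklore] -/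
theorem thetaStar_row_all_sep_all :
    rowG tauThetaStar 8 17216 3 (prodsLThetaStar.filter fun p => suppAt p.gK Pat3.all Pat3.sep) Pat3.all Pat3.sep Pat3.all = true := by
  decide +kernel

/-- Row `(all, sep, xy_s)` of the ThetaStar certificate check (kernel evaluation). [folklore] -/
theorem thetaStar_row_all_sep_xy_s :
    rowG tauThetaStar 8 17216 3 (prodsLThetaStar.filter fun p => suppAt p.gK Pat3.all Pat3.sep) Pat3.all Pat3.sep Pat3.xy_s = true := by
  decide +kernel

/-- Row `(all, sep, xs_y)` of the ThetaStar certificate check (kernel evaluation). [folklore] -/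
theorem thetaStar_row_all_sep_xs_y :
    rowG tauThetaStar 8 17216 3 (prodsLThetaStar.filter fun p => suppAt p.gK Pat3.all Pat3.sep) Pat3.all Pat3.sep Pat3.xs_y = true := by
  decide +kernel

/-- Row `(all, sep, ys_x)` of the ThetaStar certificate check (kernel evaluation). [folklore] -/
theorem thetaStar_row_all_sep_ys_x :
    rowG tauThetaStar 8 17216 3 (prodsLThetaStar.filter fun p => suppAt p.gK Pat3.all Pat3.sep) Pat3.all Pat3.sep Pat3.ys_x = true := by
  decide +kernel

/-- Row `(all, sep, sep)` of the ThetaStar certificate check (kernel evaluation). [folklore] -/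
theorem thetaStar_row_all_sep_sep :
    rowG tauThetaStar 8 17216 3 (prodsLThetaStar.filter fun p => suppAt p.gK Pat3.all Pat3.sep) Pat3.all Pat3.sep Pat3.sep = true := by
  decide +kernel

/-- Pair `(all, all)` of the ThetaStar certificate check, from its five rows. [folklore] -/
theorem thetaStar_pair_all_all : loop1G tauThetaStar 8 17216 3 (prodsLThetaStar.filter fun p => suppAt p.gK Pat3.all Pat3.all) Pat3.all Pat3.all = true :=
  loop1G_of_rows fun R => by
    cases R; exacts [thetaStar_row_all_all_all, thetaStar_row_all_all_xy_s, thetaStar_row_all_all_xs_y, thetaStar_row_all_all_ys_x, thetaStar_row_all_all_sep]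

/-- Pair `(all, xy_s)` of the ThetaStar certificate check, from its five rows. [folklore] -/
theorem thetaStar_pair_all_xy_s : loop1G tauThetaStar 8 17216 3 (prodsLThetaStar.filter fun p => suppAt p.gK Pat3.all Pat3.xy_s) Pat3.all Pat3.xy_s = true :=
  loop1G_of_rows fun R => by
    cases R; exacts [thetaStar_row_all_xy_s_all, thetaStar_row_all_xy_s_xy_s, thetaStar_row_all_xy_s_xs_y, thetaStar_row_all_xy_s_ys_x, thetaStar_row_all_xy_s_sep]

/-- Pair `(all, xs_y)` of the ThetaStar certificate check, from its five rows. [folklore] -/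
theorem thetaStar_pair_all_xs_y : loop1G tauThetaStar 8 17216 3 (prodsLThetaStar.filter fun p => suppAt p.gK Pat3.all Pat3.xs_y) Pat3.all Pat3.xs_y = true :=
  loop1G_of_rows fun R => by
    cases R; exacts [thetaStar_row_all_xs_y_all, thetaStar_row_all_xs_y_xy_s, thetaStar_row_all_xs_y_xs_y, thetaStar_row_all_xs_y_ys_x, thetaStar_row_all_xs_y_sep]

/-- Pair `(all, ys_x)` of the ThetaStar certificate check, from its five rows. [folklore] -/
theorem thetaStar_pair_all_ys_x : loop1G tauThetaStar 8 17216 3 (prodsLThetaStar.filter fun p => suppAt p.gK Pat3.all Pat3.ys_x) Pat3.all Pat3.ys_x = true :=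
  loop1G_of_rows fun R => by
    cases R; exacts [thetaStar_row_all_ys_x_all, thetaStar_row_all_ys_x_xy_s, thetaStar_row_all_ys_x_xs_y, thetaStar_row_all_ys_x_ys_x, thetaStar_row_all_ys_x_sep]

/-- Pair `(all, sep)` of the ThetaStar certificate check, from its five rows. [folklore] -/
theorem thetaStar_pair_all_sep : loop1G tauThetaStar 8 17216 3 (prodsLThetaStar.filter fun p => suppAt p.gK Pat3.all Pat3.sep) Pat3.all Pat3.sep = true :=
  loop1G_of_rows fun R => by
    cases R; exacts [thetaStar_row_all_sep_all, thetaStar_row_all_sep_xy_s, thetaStar_row_all_sep_xs_y, thetaStar_row_all_sep_ys_x, thetaStar_row_all_sep_sep]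

end Data

end FK

end Summit.CriticalPhenomena.PercolationContinuityZ3.Theorems

end
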